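import Literature.AlgebraicGeometry.Motives.CartierDivisorAmple
import Mathlib.RingTheory.Flat.Basic
import HarnessLib

/-!
# Sections of `𝒪_X(D)` over an open subset, as a module over a base ring (Görtz–Wedhorn I, (11.9))

For a Cartier divisor `D = (U_i, f_i)` on an integral scheme `X` (`Motives/CartierDivisor`) and
an open `W ⊆ X`, Görtz–Wedhorn I, (11.9) defines the invertible sheaf `𝒪_X(D) ⊆ 𝒦_X` by
`Γ(W, 𝒪_X(D)) = {f ∈ K(X) ; f_i f ∈ Γ(U_i ∩ W, 𝒪_X) for all i}`. `Motives/CartierDivisor` has the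
case `W = X` (`CartierDivisor.IsSection`, `CartierDivisor.sections`); this file supplies general `W`,
which is what the Čech complex of `𝒪_X(D)` on an open cover is made of
(`Literature/Algebra/Homology/OrderedCech` takes exactly such a monotone family of submodules of
`K(X)`):

* for `CartierDivisor.IsSectionOn D W s` (`s ∈ Γ(W, 𝒪_X(D))`, from `Motives/CartierDivisorAmple`):
  antitone in `W`, one chart suffices on `W ⊆ U_i` (`isSectionOn_iff_of_le`), stable under
  multiplication by functions regular on `W`;
* `CartierDivisor.sectionsOn D W hρ : Submodule A K(X)` — `Γ(W, 𝒪_X(D))` as a submodule of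
  `K(X)` over any commutative ring `A` for which `K(X)` is an `A`-algebra with structure map
  regular on `W` (`hρ`); in the application `A = Γ(V, 𝒪_T)` for an affine open `V` of a base
  scheme `T` acting through `Γ(V, 𝒪_T) → Γ(pr⁻¹V, 𝒪_X) → K(X)`. Restriction to a smaller open is
  the inclusion (`sectionsOn_mono`).
* the **trivialisation** `CartierDivisor.sectionsOnEquiv` — for `W ⊆ U_i` non-empty and
  `Γ(W, 𝒪_X)` an `A`-algebra compatibly with `K(X)`, `Γ(W, 𝒪_X) ≅ Γ(W, 𝒪_X(D))`, `g ↦ g · f_i⁻¹`,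
  is an `A`-linear isomorphism (`𝒪_X(D)|_{U_i} = f_i⁻¹ 𝒪_{U_i}`, Görtz–Wedhorn I, (11.9): `𝒪_X(D)`
  is an invertible `𝒪_X`-module), so that `Γ(W, 𝒪_X(D))` is a flat `A`-module when `Γ(W, 𝒪_X)`
  is (`flat_sectionsOn`). Surjectivity of the trivialisation is
  `Γ(W, 𝒪_X) = ⋂_{x ∈ W} 𝒪_{X,x}` (Görtz–Wedhorn I, Prop. 3.29 (3); this tree's
  `RatFn.exists_germ_eq_of_forall_isRegularAt`).

The `A`-algebra structures are instance arguments (`[Algebra A K(X)]`, `[Algebra A Γ(W, 𝒪_X)]`)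
with an explicit compatibility hypothesis; users supply them with `letI := ρ.toAlgebra`.
Mathlib searched (pin): no `𝒪_X(D)`, Cartier divisors or line bundles on schemes
(`Mathlib/AlgebraicGeometry/Modules/` has sheaves of modules and `Tilde` only);
`germ_injective_of_isIntegral`, `Module.Flat.of_linearEquiv` (used).

## References

* U. Görtz, T. Wedhorn, *Algebraic Geometry I: Schemes*, 2nd ed., Springer Spektrum (2020),
  doi:10.1007/978-3-658-30733-2: (11.9), pp. 373–374 (`𝒪_X(D)`, its sections over `V`,
  invertibility); Prop. 3.29 (3), p. 102. [GortzWedhorn2020]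
-/

universe u

open CategoryTheory AlgebraicGeometry TopologicalSpace Opposite

noncomputable section

namespace Literature.AlgebraicGeometry.Motives

open RatFn

namespace CartierDivisor

variable {X : Scheme.{u}} [IsIntegral X] (D : CartierDivisor X)

/-! ### Sections of `𝒪_X(D)` over an open subset -/

/-! `CartierDivisor.IsSectionOn D W s` (`Motives/CartierDivisorAmple`; `W : Set X`) is
`s ∈ Γ(W, 𝒪_X(D))`: `f_i s ∈ 𝒪_{X,x}` for every `x ∈ W ∩ U_i` (Görtz–Wedhorn I, (11.9)). It is used
here for the underlying sets of opens `W : X.Opens`. -/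

variable {D}

/-- Restriction: a section over `W` is a section over every smaller subset. [folklore] -/
theorem IsSectionOn.mono {W W' : Set X} (h : W' ⊆ W) {s : X.functionField}
    (hs : D.IsSectionOn W s) : D.IsSectionOn W' s := fun i x hi hx => hs i x hi (h hx)

/-- `0 ∈ Γ(W, 𝒪_X(D))`. [folklore] -/
theorem isSectionOn_zero (W : X.Opens) : D.IsSectionOn W 0 := fun i x _ _ => by
  rw [mul_zero]; exact isRegularAt_zero

/-- `Γ(W, 𝒪_X(D))` is stable under addition. [folklore] -/
theorem IsSectionOn.add {W : X.Opens} {s t : X.functionField} (hs : D.IsSectionOn W s)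
    (ht : D.IsSectionOn W t) : D.IsSectionOn W (s + t) := fun i x hi hx => by
  rw [mul_add]; exact (hs i x hi hx).add (ht i x hi hx)

/-- `Γ(W, 𝒪_X(D))` is stable under multiplication by functions regular on `W` (it is a
`Γ(W, 𝒪_X)`-module). [folklore] -/
theorem IsSectionOn.mul_left {W : X.Opens} {g s : X.functionField}
    (hg : ∀ x ∈ W, IsRegularAt x g) (hs : D.IsSectionOn W s) : D.IsSectionOn W (g * s) :=
  fun i x hi hx => by rw [mul_left_comm]; exact (hg x hx).mul (hs i x hi hx)

/-- **One chart suffices**: on an open `W ⊆ U_i`, `s ∈ Γ(W, 𝒪_X(D))` iff `f_i s` is regular on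
`W` (`f_j s = (f_j / f_i)(f_i s)` with `f_j / f_i` a unit on `U_i ∩ U_j`; Görtz–Wedhorn I, (11.9):
`𝒪_X(D)|_{U_i} = f_i⁻¹ 𝒪_{U_i}`). [cite: GortzWedhorn2020, Section (11.9) (p. 374)] -/
theorem isSectionOn_iff_of_le {W : X.Opens} {i : D.ι} (hW : W ≤ D.U i) {s : X.functionField} :
    D.IsSectionOn W s ↔ ∀ x ∈ W, IsRegularAt x (D.f i * s) := by
  refine ⟨fun h x hx => h i x (hW hx) hx, fun h j x hj hx => ?_⟩
  have e : D.f j * s = D.f j / D.f i * (D.f i * s) := by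
    field_simp [D.f_ne_zero i]
  rw [e]
  exact (D.isUnitAt_div j i x hj (hW hx)).isRegularAt.mul (h x hx)

/-- The rational function `g f_i⁻¹` of a section `g ∈ Γ(W, 𝒪_X)` lies in `Γ(W, 𝒪_X(D))` when
`W ⊆ U_i` (is non-empty). [folklore] -/
theorem isSectionOn_ofSection_mul_inv {W : X.Opens} (hξ : genericPoint X ∈ W) {i : D.ι}
    (hW : W ≤ D.U i) (g : Γ(X, W)) : D.IsSectionOn W (ofSection hξ g * (D.f i)⁻¹) := by
  rw [isSectionOn_iff_of_le hW]
  intro x hx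
  rw [mul_comm, inv_mul_cancel_right₀ (D.f_ne_zero i)]
  exact isRegularAt_ofSection hx g

/-! ### `Γ(W, 𝒪_X(D))` as a module over a base ring -/

variable {A : Type u} [CommRing A] [Algebra A X.functionField] (D)

/-- **`Γ(W, 𝒪_X(D))` as an `A`-submodule of `K(X)`**, for `K(X)` an `A`-algebra whose structure
map `A → K(X)` consists of functions regular on `W` (so that `a · Γ(W, 𝒪_X(D)) ⊆ Γ(W, 𝒪_X(D))`).
[cite: GortzWedhorn2020, Section (11.9) (p. 374)] -/
def sectionsOn (W : X.Opens) (hρ : ∀ a, ∀ x ∈ W, IsRegularAt x (algebraMap A X.functionField a)) :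
    Submodule A X.functionField where
  carrier := {s | D.IsSectionOn W s}
  zero_mem' := isSectionOn_zero W
  add_mem' hs ht := hs.add ht
  smul_mem' a _ hs := by
    rw [Algebra.smul_def]
    exact hs.mul_left (hρ a)

variable {D}

/-- Membership in `sectionsOn`. [folklore] -/
@[simp] theorem mem_sectionsOn_iff {W : X.Opens}
    {hρ : ∀ a, ∀ x ∈ W, IsRegularAt x (algebraMap A X.functionField a)} {s : X.functionField} :
    s ∈ D.sectionsOn W hρ ↔ D.IsSectionOn W s := Iff.rfl

/-- **Restriction is inclusion**: `Γ(W, 𝒪_X(D)) ⊆ Γ(W', 𝒪_X(D))` inside `K(X)` for `W' ⊆ W`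
(the family `W ↦ Γ(W, 𝒪_X(D))` is antitone). [folklore] -/
theorem sectionsOn_mono {W W' : X.Opens} (h : W' ≤ W)
    (hρ : ∀ a, ∀ x ∈ W, IsRegularAt x (algebraMap A X.functionField a))
    (hρ' : ∀ a, ∀ x ∈ W', IsRegularAt x (algebraMap A X.functionField a)) :
    D.sectionsOn W hρ ≤ D.sectionsOn W' hρ' := fun _ hs => IsSectionOn.mono h hs

/-! ### The trivialisation `Γ(W, 𝒪_X) ≅ Γ(W, 𝒪_X(D))` on a chart -/

section Trivialisation

variable {W : X.Opens} [Algebra A Γ(X, W)]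

/-- **The trivialisation of `𝒪_X(D)` on a chart, as an `A`-linear map**
`Γ(W, 𝒪_X) → Γ(W, 𝒪_X(D))`, `g ↦ g f_i⁻¹` (`W ⊆ U_i` non-empty; `Γ(W, 𝒪_X)` and `K(X)` are
`A`-algebras compatibly: `hσ`). [cite: GortzWedhorn2020, Section (11.9) (p. 374)] -/
def trivialisation (hξ : genericPoint X ∈ W) {i : D.ι} (hW : W ≤ D.U i)
    (hσ : ∀ a, ofSection hξ (algebraMap A Γ(X, W) a) = algebraMap A X.functionField a)
    (hρ : ∀ a, ∀ x ∈ W, IsRegularAt x (algebraMap A X.functionField a)) :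
    Γ(X, W) →ₗ[A] D.sectionsOn W hρ where
  toFun g := ⟨ofSection hξ g * (D.f i)⁻¹, isSectionOn_ofSection_mul_inv hξ hW g⟩
  map_add' g g' := by
    apply Subtype.ext
    simp only [Submodule.coe_add, map_add, add_mul]
  map_smul' a g := by
    apply Subtype.ext
    simp only [RingHom.id_apply, SetLike.val_smul, Algebra.smul_def, map_mul, hσ, mul_assoc]

/-- The rational function of `trivialisation g` is `g f_i⁻¹`. [folklore] -/
@[simp] theorem coe_trivialisation (hξ : genericPoint X ∈ W) {i : D.ι} (hW : W ≤ D.U i)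
    (hσ : ∀ a, ofSection hξ (algebraMap A Γ(X, W) a) = algebraMap A X.functionField a)
    (hρ : ∀ a, ∀ x ∈ W, IsRegularAt x (algebraMap A X.functionField a)) (g : Γ(X, W)) :
    (D.trivialisation hξ hW hσ hρ g : X.functionField) = ofSection hξ g * (D.f i)⁻¹ := rfl

/-- The trivialisation is injective (`Γ(W, 𝒪_X) → K(X)` is injective on an integral scheme,
Görtz–Wedhorn I, Prop. 3.29 (2)). [folklore] -/
theorem trivialisation_injective (hξ : genericPoint X ∈ W) {i : D.ι} (hW : W ≤ D.U i)
    (hσ : ∀ a, ofSection hξ (algebraMap A Γ(X, W) a) = algebraMap A X.functionField a)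
    (hρ : ∀ a, ∀ x ∈ W, IsRegularAt x (algebraMap A X.functionField a)) :
    Function.Injective (D.trivialisation hξ hW hσ hρ) := by
  intro g g' h
  have h' := congr_arg (fun s : D.sectionsOn W hρ => (s : X.functionField)) h
  simp only [coe_trivialisation] at h'
  exact germ_injective_of_isIntegral X _ hξ (mul_right_cancel₀ (inv_ne_zero (D.f_ne_zero i)) h')

/-- The trivialisation is surjective: for `s ∈ Γ(W, 𝒪_X(D))` the rational function `f_i s` is
regular on `W`, hence a section over `W` (`Γ(W, 𝒪_X) = ⋂_{x ∈ W} 𝒪_{X,x}`, Görtz–Wedhorn I,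
Prop. 3.29 (3)). [cite: GortzWedhorn2020, Prop. 3.29 (3) (p. 102)] -/
theorem trivialisation_surjective (hξ : genericPoint X ∈ W) {i : D.ι} (hW : W ≤ D.U i)
    (hσ : ∀ a, ofSection hξ (algebraMap A Γ(X, W) a) = algebraMap A X.functionField a)
    (hρ : ∀ a, ∀ x ∈ W, IsRegularAt x (algebraMap A X.functionField a)) :
    Function.Surjective (D.trivialisation hξ hW hσ hρ) := by
  intro s
  have hs : ∀ x ∈ W, IsRegularAt x (D.f i * (s : X.functionField)) :=
    (isSectionOn_iff_of_le hW).1 s.2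
  obtain ⟨g, hg⟩ := exists_germ_eq_of_forall_isRegularAt hξ hs
  refine ⟨g, Subtype.ext ?_⟩
  rw [coe_trivialisation, show ofSection hξ g = D.f i * (s : X.functionField) from hg, mul_comm,
    inv_mul_cancel_left₀ (D.f_ne_zero i)]

/-- **`Γ(W, 𝒪_X) ≅ Γ(W, 𝒪_X(D))` as `A`-modules** on a non-empty open `W ⊆ U_i`: the invertible
sheaf `𝒪_X(D)` is trivialised by `f_i⁻¹` on `U_i` (Görtz–Wedhorn I, (11.9)).
[cite: GortzWedhorn2020, Section (11.9) (p. 374)] -/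
def sectionsOnEquiv (hξ : genericPoint X ∈ W) {i : D.ι} (hW : W ≤ D.U i)
    (hσ : ∀ a, ofSection hξ (algebraMap A Γ(X, W) a) = algebraMap A X.functionField a)
    (hρ : ∀ a, ∀ x ∈ W, IsRegularAt x (algebraMap A X.functionField a)) :
    Γ(X, W) ≃ₗ[A] D.sectionsOn W hρ :=
  LinearEquiv.ofBijective (D.trivialisation hξ hW hσ hρ)
    ⟨trivialisation_injective hξ hW hσ hρ, trivialisation_surjective hξ hW hσ hρ⟩

/-- The rational function of `sectionsOnEquiv g` is `g f_i⁻¹`. [folklore] -/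
@[simp] theorem coe_sectionsOnEquiv (hξ : genericPoint X ∈ W) {i : D.ι} (hW : W ≤ D.U i)
    (hσ : ∀ a, ofSection hξ (algebraMap A Γ(X, W) a) = algebraMap A X.functionField a)
    (hρ : ∀ a, ∀ x ∈ W, IsRegularAt x (algebraMap A X.functionField a)) (g : Γ(X, W)) :
    (D.sectionsOnEquiv hξ hW hσ hρ g : X.functionField) = ofSection hξ g * (D.f i)⁻¹ := rfl

/-- **`Γ(W, 𝒪_X(D))` is a flat `A`-module as soon as `Γ(W, 𝒪_X)` is** (through the
trivialisation; e.g. `W` affine and flat over an affine base). [folklore] -/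
theorem flat_sectionsOn [Module.Flat A Γ(X, W)] (hξ : genericPoint X ∈ W) {i : D.ι}
    (hW : W ≤ D.U i)
    (hσ : ∀ a, ofSection hξ (algebraMap A Γ(X, W) a) = algebraMap A X.functionField a)
    (hρ : ∀ a, ∀ x ∈ W, IsRegularAt x (algebraMap A X.functionField a)) :
    Module.Flat A (D.sectionsOn W hρ) :=
  Module.Flat.of_linearEquiv (D.sectionsOnEquiv hξ hW hσ hρ).symm

end Trivialisation

end CartierDivisor

end Literature.AlgebraicGeometry.Motives

end
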